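import Literature.Computability.QuantumComplexity.PolyThreshold
import Literature.Computability.Complexity.IterateFPPoly
import Literature.Computability.Complexity.CountingHierarchyProofs
import HarnessLib

/-!
# The WINDOW read-out of the `K(n)`-copy family: counting the ones in a window of every block

Topic `Literature/Computability/QuantumComplexity`; sequel of `PolyMajority.lean` / `PolyThreshold.lean` (read-outs that
collect ONE answer bit per copy — position `blk n j 0` — and compare the count with `K/2` resp. an instance-dependent
rational threshold). When one "copy" of the repeated quantum experiment carries SEVERAL answer bits — e.g. a block made of
`m` juxtaposed sub-runs, one per oracle gate of an algorithm, each writing one flag — the classical read-out must count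
the ones in a WINDOW of each block: positions `blk n j 0 + off, …, blk n j 0 + off + cnt − 1`, with the offset `off` and
the width `cnt` computed in polynomial time from the instance (here: the LENGTHS of two `FP` string functions `offU`,
`cntU`). The total over the copies is then compared with the threshold exactly as in `PolyThreshold.lean` (the final
comparison `thrPost` is reused verbatim), and its concentration is `PolyCopiesStatWindow.kernelProb_ge_of_stat_window`
(statistic with values in `[0, cnt]`). This is still Watrous's threshold count (2009, §IV.2 Prop. 3), with a bounded
integer statistic per trial instead of a bit (Chebyshev for sample means, Arora–Barak 2009, Lemma A.12).

* `PolyCopies.winBody`, `winLoop`, **`PolyCopies.winThrF`** — the loop collecting the window of every block (a counted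
  loop of `K(|x|)` rounds, `Brick.loopStep`; growth polynomial in `|x|`, `loopFn_mem_FP_of_poly`) followed by `thrPost`;
  `winThrF_mem_FP`;
* `PolyCopies.winCount` and **`winThrF_boolPair`** — the value: the bit
  `[⟦num x⟧ · K(|x|) ≤ ⟦den x⟧ · Σ_{j<K} #ones(y[blk j 0 + off .. + cnt))]`.

Everything here is PROVED; definitions are explicit string functions.

## References

* J. Watrous, *Quantum computational complexity*, Springer Encyclopedia 2009 (arXiv:0804.3401), §IV.2 Prop. 3 (proof)
  [Watrous2009].
* S. Arora, B. Barak, *Computational Complexity: A Modern Approach*, CUP 2009, §1.3 (bounded loops), Appendix A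
  [AroraBarak2009].
* C. H. Bennett, E. Bernstein, G. Brassard, U. Vazirani, SIAM J. Comput. 26 (1997), Thm. 4.13 (proof, step 4: the
  classical combination of the copies' answers) [BennettBernsteinBrassardVazirani1997].
-/

noncomputable section

namespace Literature.Computability.QuantumComplexity

namespace PolyCopies

open _root_.Computability Polynomial Complexity Complexity.Brick Plumb HashBricks Cryptography Finset

variable (P : Params) (offU cntU num den : List Bool → List Bool)

/-! ### The window loop -/

/-- The body of the window loop on records `⟨x, ⟨cnt, ⟨acc, rest⟩⟩⟩`: prepend the window
`(rest.drop |offU x|).take |cntU x|` to `acc` and drop one block width `b |x|` of `rest`.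
[cite: AroraBarak2009, §1.3 (bounded loops)] -/
def winBody : List Bool → List Bool :=
  fanoutFn (appF ∘ fanoutFn (takeFn ∘ fanoutFn (cntU ∘ nthF 0) (dropFn ∘ fanoutFn (offU ∘ nthF 0) (sndPow 2))) (nthF 2))
    (dropFn ∘ fanoutFn (polyFn (bPoly P) ∘ nthF 0) (sndPow 2))

/-- The window loop: `K(|x|)` rounds of `winBody` (started by `majInit`). [cite: AroraBarak2009, §1.3] -/
def winLoop : List Bool → List Bool := fun z => (loopStep (winBody P offU cntU))^[(KPoly P).eval (fstF z).length] z

/-- **The window threshold read-out**: collect the windows, then compare `⟦num x⟧ · K(|x|) ≤ ⟦den x⟧ · #ones`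
(`thrPost` of `PolyThreshold.lean`). [cite: Watrous2009, §IV.2 Prop. 3 (proof)] -/
def winThrF : List Bool → List Bool := thrPost P num den ∘ winLoop P offU cntU ∘ majInit P

variable {P offU cntU num den}

/-- Growth of the loop body: the state grows by at most `2 |cntU x| + 4` symbols per round. [cite: AroraBarak2009, §1.3] -/
theorem length_winBody_le (z : List Bool) :
    (winBody P offU cntU z).length ≤ (sndPow 1 z).length + (2 * (cntU (nthF 0 z)).length + 4) := by
  have h1 : 2 * (nthF 2 z).length + (sndPow 2 z).length ≤ (sndPow 1 z).length := length_nthF_succ_add_sndPow_succ_le 1 z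
  have htake : (takeFn (boolPair (cntU (nthF 0 z)) (dropFn (boolPair (offU (nthF 0 z)) (sndPow 2 z))))).length ≤
      (cntU (nthF 0 z)).length := by
    rw [takeFn_boolPair]; exact List.length_take_le _ _
  have hdrop : (dropFn (boolPair (polyFn (bPoly P) (nthF 0 z)) (sndPow 2 z))).length ≤ (sndPow 2 z).length := by
    rw [dropFn_boolPair, List.length_drop]; exact Nat.sub_le _ _
  simp only [winBody, fanoutFn_apply, Function.comp_apply, length_boolPair, appF, fstF_boolPair, sndF_boolPair,
    List.length_append]
  omega

/-- `winBody ∈ FP` (for `offU, cntU ∈ FP`). [cite: AroraBarak2009, §1.3] -/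
theorem winBody_mem_FP (hoff : offU ∈ FP) (hcnt : cntU ∈ FP) : winBody P offU cntU ∈ FP :=
  fanoutFn_mem_FP
    (comp_mem_FP appF_mem_FP (fanoutFn_mem_FP
      (comp_mem_FP takeFn_mem_FP (fanoutFn_mem_FP (comp_mem_FP hcnt (nthF_mem_FP 0))
        (comp_mem_FP dropFn_mem_FP (fanoutFn_mem_FP (comp_mem_FP hoff (nthF_mem_FP 0)) (sndPow_mem_FP 2)))))
      (nthF_mem_FP 2)))
    (comp_mem_FP dropFn_mem_FP (fanoutFn_mem_FP (comp_mem_FP (polyFn_mem_FP _) (nthF_mem_FP 0)) (sndPow_mem_FP 2)))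

/-- `winLoop ∈ FP`: polynomially many rounds of polynomial growth (the width function `cntU ∈ FP` has polynomially
bounded output length). [cite: AroraBarak2009, §1.3 (bounded loops in polynomial time)] -/
theorem winLoop_mem_FP (hoff : offU ∈ FP) (hcnt : cntU ∈ FP) : winLoop P offU cntU ∈ FP := by
  obtain ⟨G, hG⟩ := exists_poly_length_le_of_mem_FP hcnt
  refine loopFn_mem_FP_of_poly (winBody_mem_FP hoff hcnt) (2 * G + 4) (fun z => ?_) (KPoly P)
  have h := length_winBody_le (P := P) (offU := offU) (cntU := cntU) z
  have hx : (cntU (nthF 0 z)).length ≤ G.eval (fstF z).length := by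
    have := hG (nthF 0 z)
    simpa [nthF] using this
  have hev : (2 * G + 4 : Polynomial ℕ).eval (fstF z).length = 2 * G.eval (fstF z).length + 4 := by
    simp [Polynomial.eval_add, Polynomial.eval_mul]
  rw [hev]
  omega

/-- **The window read-out is polynomial time** (for `offU, cntU, num, den ∈ FP`). [cite: Watrous2009, §IV.2 Prop. 3 (proof)] -/
theorem winThrF_mem_FP (hoff : offU ∈ FP) (hcnt : cntU ∈ FP) (hnum : num ∈ FP) (hden : den ∈ FP) :
    winThrF P offU cntU num den ∈ FP :=
  comp_mem_FP (thrPost_mem_FP hnum hden) (comp_mem_FP (winLoop_mem_FP hoff hcnt) majInit_mem_FP)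

/-! ### Semantics -/

/-- The collected windows after `i` rounds (latest first). [cite: Watrous2009, §IV.2 Prop. 3 (proof)] -/
def winAcc (n off cnt : ℕ) (y : List Bool) : ℕ → List Bool
  | 0 => []
  | i + 1 => ((restAt (P := P) n y i).drop off).take cnt ++ winAcc n off cnt y i

/-- One round of the body on a well-formed record. [cite: AroraBarak2009, §1.3] -/
theorem winBody_record (x c : List Bool) (y : List Bool) (i : ℕ) :
    winBody P offU cntU (boolPair x (boolPair c (boolPair
        (winAcc (P := P) x.length (offU x).length (cntU x).length y i) (restAt (P := P) x.length y i)))) =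
      boolPair (winAcc (P := P) x.length (offU x).length (cntU x).length y (i + 1))
        (restAt (P := P) x.length y (i + 1)) := by
  simp only [winBody, fanoutFn_apply, Function.comp_apply, sndPow_succ_boolPair, sndPow_zero_boolPair, nthF_succ_boolPair,
    nthF_zero_boolPair, takeFn_boolPair, dropFn_boolPair, polyFn_apply, eval_bPoly, appF, fstF_boolPair, sndF_boolPair,
    winAcc, restAt, List.drop_drop, ones, List.length_replicate]
  congr 2
  ring

/-- The loop model runs the rounds. [cite: AroraBarak2009, §1.3] -/
theorem loopModel_winBody (x : List Bool) (y : List Bool) : ∀ (k i : ℕ),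
    loopModel (winBody P offU cntU) x k (boolPair
        (winAcc (P := P) x.length (offU x).length (cntU x).length y i) (restAt (P := P) x.length y i)) =
      boolPair (winAcc (P := P) x.length (offU x).length (cntU x).length y (i + k))
        (restAt (P := P) x.length y (i + k))
  | 0, i => rfl
  | k + 1, i => by
    rw [loopModel, winBody_record, loopModel_winBody x y k (i + 1)]
    congr 2 <;> ring

/-- The number of ones in the window of block `j`: `#ones (y[blk j 0 + off .. blk j 0 + off + cnt))`.
[cite: Watrous2009, §IV.2 Prop. 3 (proof)] -/
def winOnes (n off cnt : ℕ) (y : List Bool) (j : ℕ) : ℕ := ((y.drop (blk P n j 0 + off)).take cnt).count true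

/-- Counting the collected ones. [cite: Watrous2009, §IV.2 Prop. 3 (proof)] -/
theorem count_winAcc (n off cnt : ℕ) (y : List Bool) : ∀ i : ℕ,
    (winAcc (P := P) n off cnt y i).count true = ∑ j ∈ Finset.range i, winOnes (P := P) n off cnt y j
  | 0 => by simp [winAcc]
  | i + 1 => by
    rw [winAcc, List.count_append, count_winAcc n off cnt y i, Finset.sum_range_succ, add_comm]
    congr 1
    have hpos : blk P n i 0 = base P n + i * b P n := by unfold blk; omega
    simp only [winOnes, restAt, hpos, List.drop_drop]

/-- The total number of ones in the windows of the `K(|x|)` blocks. [cite: Watrous2009, §IV.2 Prop. 3 (proof)] -/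
def winCount (x y : List Bool) : ℕ :=
  ∑ j ∈ Finset.range (K P x.length), winOnes (P := P) x.length (offU x).length (cntU x).length y j

/-- **Semantics of the window read-out**: the bit `[⟦num x⟧ · K(|x|) ≤ ⟦den x⟧ · winCount x y]`.
[cite: Watrous2009, §IV.2 Prop. 3 (proof)] -/
theorem winThrF_boolPair (x y : List Bool) :
    winThrF P offU cntU num den (boolPair x y) =
      [decide (bitsToNat (num x) * K P x.length ≤ bitsToNat (den x) * winCount (P := P) (offU := offU) (cntU := cntU) x y)] := by
  have hinit : majInit P (boolPair x y) =
      boolPair x (boolPair (encodeNat (K P x.length))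
        (boolPair (winAcc (P := P) x.length (offU x).length (cntU x).length y 0) (restAt (P := P) x.length y 0))) := by
    simp [majInit, fanoutFn_apply, winAcc, restAt, ones]
  have hloop : winLoop P offU cntU (majInit P (boolPair x y)) =
      boolPair x (boolPair [] (boolPair (winAcc (P := P) x.length (offU x).length (cntU x).length y (K P x.length))
        (restAt (P := P) x.length y (K P x.length)))) := by
    rw [winLoop, hinit, fstF_boolPair, eval_KPoly,
      iterate_loopStep (winBody P offU cntU) x (K P x.length) (K P x.length) _ le_rfl,
      loopModel_winBody x y (K P x.length) 0, Nat.zero_add]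
  rw [winThrF, Function.comp_apply, Function.comp_apply, hloop]
  have hlt : (ltFn ∘ fanoutFn (prodFn ∘ fanoutFn (den ∘ nthF 0) (popCountFn ∘ nthF 2))
      (prodFn ∘ fanoutFn (num ∘ nthF 0) (lenBinF ∘ polyFn (KPoly P) ∘ nthF 0)))
      (boolPair x (boolPair [] (boolPair (winAcc (P := P) x.length (offU x).length (cntU x).length y (K P x.length))
        (restAt (P := P) x.length y (K P x.length))))) =
      [decide (bitsToNat (den x) * winCount (P := P) (offU := offU) (cntU := cntU) x y <
        bitsToNat (num x) * K P x.length)] := by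
    simp only [Function.comp_apply, fanoutFn_apply, nthF_zero_boolPair, nthF_succ_boolPair, polyFn_apply, eval_KPoly,
      lenBinF_apply, ones, List.length_replicate, popCountFn_apply, ltFn_boolPair, prodFn_boolPair, bitsToNat_encodeNat,
      count_winAcc, winCount]
    congr 1
  rw [thrPost, notFn_apply hlt]
  simp only [List.cons.injEq, and_true]
  rw [← decide_not, decide_eq_decide]
  exact not_lt

/-- The window count read off a measured register: a sum over the blocks of a statistic of the block contents — the
shape consumed by `PolyCopiesStatWindow.kernelProb_ge_of_stat_window`. [cite: NielsenChuang2010, §2.2.8] -/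
theorem winOnes_ofFn (x : List Bool) (z : QReg (x.length + anc P x.length)) (j : Fin (K P x.length)) (off cnt : ℕ) :
    winOnes (P := P) x.length off cnt (List.ofFn z) j =
      (((List.ofFn z).drop (blk P x.length j 0 + off)).take cnt).count true := rfl

end PolyCopies

end Literature.Computability.QuantumComplexity

end
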